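import Summits.HodgeConjecture.HodgeConjecture.Theorems.F0P2cStubCI                    -- ★ p800717: `rhoAtLine_chi_isIrreducible`, `rhoAtLine_chi_isAdmissible` (general CM frames)
import Summits.HodgeConjecture.HodgeConjecture.Theorems.F0P3FinPartIsotypic              -- ★ p812238+ F0P3-p03 (g5): I♭ `isotypicComponent_finRep_smoothPart_eq_top`, `isIsotypicOfType_finRep_smoothPart`
import Summits.HodgeConjecture.HodgeConjecture.Theorems.F0P3FinRepConstituentsExist      -- ★ `exists_intertwiningMap_smoothPart_of_hasFinComponent` (σ ↪ P.finRep^∞)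
import Literature.RepresentationTheory.Liu2021.GlobalOscillatorIsomorphismCriterion      -- ✔ `nonempty_linearEquiv_of_isotypicComponent_eq_top_of_isIsotypicOfType` (Bump 3.4.1 ∕ Flath Thm 3 uniqueness)
import Literature.RepresentationTheory.Semisimple.Multiplicity                         -- ★ `Representation.nontrivial_of_isIrreducible`
import HarnessLib

/-!
# Crux `H413` · programme P2 · E3 rung 3 — STUB **F-ISO** CLOSED, LETTER-FREE: FINITE ISOTYPY OF A DISCRETE AUTOMORPHIC `P`
# AT TWO THETA CARRIERS — `stubFinIsotypy_holds : ‹StubFinIsotypyTheta›` (body of `Cruxes/H413/Lines/F0_P2E3Rung3.lean` v1 §1 :320 VERBATIM)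

Cell hodgecm-mathlib (D-0151), FLOOR 0, crux item H413 = stmt-HodgeConjecture-24833; sub-line `Cruxes/H413/Lines/F0_P2E3Rung3.lean` v1
(F0P2-plan (g7), 809baa7acc4bedcc; registered stub `stub_finIsotypy_theta : StubFinIsotypyTheta` :559).  Author F0P2-p01 (g6) (row F-ISO, census
2026-08-31T12:3xZ; ref1 r123).  THEOREMS ONLY (no `def`, no instance, no notation, no named fact, no `sorry`); kernel lane
`--supports stmt-HodgeConjecture-24833 --as helper`; never imports a `Cruxes/…/Lines` module (O50-1) — the registered text is PASTED VERBATIM as the type.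
HONEST LABEL: HC_CM is proved only modulo the printed citations until rung 0 closes; this file discharges NO printed citation and introduces none.

THE STATEMENT (`StubFinIsotypyTheta`, :320): for the (C♭) frame data, an automorphic measure `μA` and a discrete automorphic `P` of `U(H)`: if both
Liu carriers `ω_H(μ, a, χ)` and `ω_H(μ′, a′, χ′)` occur in `P` (`HasFinComponent` = an injective `U(H)(𝔸_{L⁺,f})`-intertwiner into `P.finRep`),
then they are `U(H)(𝔸_{L⁺,f})`-equivalent (a `ℂ`-linear equivalence intertwining `rhoAtLine … ιV a χ` and `rhoAtLine … ιV a′ χ′`).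

THE PROOF (Flath's uniqueness clause, every input ★ — the card's «letter-grade core» is P3's brick I♭, already in the tree):
1. both carriers are irreducible and admissible (★ `F0P2cStubCI.rhoAtLine_chi_isIrreducible` ∕ `rhoAtLine_chi_isAdmissible`; N = 3, [Liu2021, Lem. D.1 (1)]
   per place ★ inside);
2. the smooth part `M` of `P|_{U(H)(𝔸_{L⁺,f})}` is `σ`-ISOTYPIC for every irreducible admissible `σ` occurring in `P` — ★
   `F0P3FinPartIsotypic.isotypicComponent_finRep_smoothPart_eq_top` (`= ⊤`, at `σ := ω_H(μ,a,χ)`) and ★ `isIsotypicOfType_finRep_smoothPart` (at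
   `σ′ := ω_H(μ′,a′,χ′)`) [FlathCorvallis1979, Thm. 3; BorelJacquet1979, §4.6; BourbakiAlgebreVIII2012, VIII §4];
3. `M ≠ 0`: `σ ↪ M` (★ `F0P3FinRepConstituentsExist.exists_intertwiningMap_smoothPart_of_hasFinComponent`) and `σ ≠ 0` (`nontrivial_of_isIrreducible`);
4. TYPE UNIQUENESS of a non-zero isotypic module: ✔ `Literature.RepresentationTheory.Liu2021.nonempty_linearEquiv_of_isotypicComponent_eq_top_of_isIsotypicOfType`
   ⟹ `σ.asModule ≃ₗ[ℂ[U(H)(𝔸_f)]] σ′.asModule` ([Bump1997, §3.4 Prop. 3.4.1 last bullet]; `IsSimpleModule` by Mathlib `irreducible_iff_isSimpleModule_asModule`);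
5. back to a `ℂ`-linear equivariant equivalence: Mathlib `Representation.IntertwiningMap.equivLinearMapAsModule … .symm` + `IntertwiningMap.ofBijective`
   (the ★ `nonempty_equiv_of_isotypicComponent_eq_top` pattern), read off pointwise.
WHY IT MIGHT HAVE FAILED (card): only if a carrier were the zero space — excluded at `N = 3` by step 1.

## References
* [Liu2021] Y. Liu, Camb. J. Math. 9 (2021) = arXiv:2102.11518: Def. 4.11 (l. 2083–2097), App. D Lem. D.1 (1) (l. 5229), §D.1 Step 1; Prop. 4.13 summary (l. 2147).
* [FlathCorvallis1979] D. Flath, PSPM 33.1 (1979), Thm. 3, Thm. 4.  [BorelJacquet1979] A. Borel, H. Jacquet, PSPM 33.1 (1979), §4.6.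
* [BourbakiAlgebreVIII2012] N. Bourbaki, *Algèbre* VIII (2012), §4 n°1–2.  [Bump1997] D. Bump, CUP (1997), §3.4 Prop. 3.4.1.
-/

set_option autoImplicit false

-- the mandated namespace has the single-problem summit's repeated segment (`HodgeConjecture.HodgeConjecture`)
set_option linter.dupNamespace false

noncomputable section

namespace Summit.HodgeConjecture.HodgeConjecture.Cruxes.H413.F0P2mFinIsotypy

open scoped Matrix TensorProduct ComplexOrder
open NumberField NumberField.InfinitePlace IsDedekindDomain MeasureTheory
open Literature.NumberTheory Literature.NumberTheory.Automorphic Literature.NumberTheory.Automorphic.UnitaryGroup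
open Literature.NumberTheory.Automorphic.Liu2021 Literature.NumberTheory.Automorphic.Liu2021.AppendixC
open Literature.NumberTheory.Automorphic.Liu2021.Def411WeilCarriers
open Literature.NumberTheory.Automorphic.Liu2021.Def411WeilCarriersDoubling
open Literature.NumberTheory.Automorphic.IdeleClassGroup
open Literature.NumberTheory.GelbartRogawski1991 Literature.NumberTheory.GelbartRogawski1991.UnitaryDualPair
open Literature.NumberTheory.GelbartRogawski1991.UnitaryDualPair.WeilCoinv
open Literature.RepresentationTheory Literature.RepresentationTheory.Liu2021
open Summit.HodgeConjecture.CorCM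
open Summit.HodgeConjecture.CorCM.Transposition

/-! ## F-ISO — the registered text as type, VERBATIM (`Lines/F0_P2E3Rung3.lean` v1 :320–398) -/

set_option synthInstance.maxHeartbeats 400000 in
set_option maxHeartbeats 16000000 in
/-- **F-ISO HOLDS — two theta carriers occurring in ONE discrete automorphic `P` of `U(H)` are `U(H)(𝔸_{L⁺,f})`-equivalent**, LETTER-FREE:
both carriers are irreducible admissible (★ CI road), the smooth part of `P|_{U(H)(𝔸_f)}` is isotypic of either type (★ P3 brick I♭), it is non-zero,
and a non-zero isotypic module has a unique simple type (✔ Bump 3.4.1 ∕ Flath Thm. 3 uniqueness, module form); Mathlib turns the `ℂ[G]`-linear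
equivalence of the modules into an equivariant `ℂ`-linear equivalence.  Type = the body of `F0P2E3Rung3.StubFinIsotypyTheta` VERBATIM (the sub-line folds
`stub_finIsotypy_theta := F0P2mFinIsotypy.stubFinIsotypy_holds`). [cite: FlathCorvallis1979, Thm. 3, Thm. 4] [cite: BorelJacquet1979, §4.6]
[cite: Bump1997, §3.4 Prop. 3.4.1] [cite: Liu2021, Def. 4.11 (l. 2092–2096), App. D Lem. D.1 (1), Prop. 4.13 summary (l. 2147)] -/
theorem stubFinIsotypy_holds :
    ∀ (L : Type) [Field L] [NumberField L] [IsCMField L] (ι : L →+* ℂ) (H : Matrix (Fin 3) (Fin 3) L) (T : GL (Fin 3) ℂ)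
      (hT : (T : Matrix (Fin 3) (Fin 3) ℂ)ᴴ * H.map ι * (T : Matrix (Fin 3) (Fin 3) ℂ) = Literature.Geometry.ComplexHyperbolic.BallModel.J),
      (∀ τ' : L →+* ℂ, InfinitePlace.mk τ' ≠ InfinitePlace.mk ι → (H.map τ').PosDef) → 2 ≤ Module.finrank ℚ ↥(maximalRealSubfield L) →
      ∀ {n' : ℕ} (e₁ : Fin 3 × Fin 1 ≃ Fin n') (dV : Fin 3 → L) (hdV : ∀ i, IsCMField.complexConj L (dV i) = dV i)
        (hdV0 : ∀ i, dV i ≠ 0) (g : GL (Fin 3) L)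
        (hg : ((g : Matrix (Fin 3) (Fin 3) L).map (cmConjRingHom L))ᵀ * H * (g : Matrix (Fin 3) (Fin 3) L) = Matrix.diagonal dV)
        (ιV : finAdelic (↥(maximalRealSubfield L)) L (IsCMField.complexConj L) 3 H →*
            finAdelic (↥(maximalRealSubfield L)) L (IsCMField.complexConj L) 3 (Matrix.diagonal dV)),
          (∀ k, ((ιV k : finAdelic (↥(maximalRealSubfield L)) L (IsCMField.complexConj L) 3 (Matrix.diagonal dV)) :
              GL (Fin 3) (FiniteAdeleRing (𝓞 L) L)) =
            (toFinAdeleGL L 3 g)⁻¹ * (k : GL (Fin 3) (FiniteAdeleRing (𝓞 L) L)) * toFinAdeleGL L 3 g) →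
          ∀ (μA : Measure (adelicGroupData (↥(maximalRealSubfield L)) L (IsCMField.complexConj L) 3 H).automorphicQuotient)
            [(adelicGroupData (↥(maximalRealSubfield L)) L (IsCMField.complexConj L) 3 H).IsAutomorphicMeasure μA],
            ∀ P : DiscreteAutomorphicRep (adelicGroupData (↥(maximalRealSubfield L)) L (IsCMField.complexConj L) 3 H) μA,
              ∀ (μ : Literature.NumberTheory.Automorphic.IdeleClassGroup L →ₜ* Circle) (hμ : IsConjugateSymplectic L μ) (a : (↥(maximalRealSubfield L))ˣ) (χ : Chi (↥(maximalRealSubfield L)) L (IsCMField.complexConj L))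
                (μ' : Literature.NumberTheory.Automorphic.IdeleClassGroup L →ₜ* Circle) (hμ' : IsConjugateSymplectic L μ') (a' : (↥(maximalRealSubfield L))ˣ) (χ' : Chi (↥(maximalRealSubfield L)) L (IsCMField.complexConj L)),
                P.HasFinComponent
                    (rhoAtLine (↥(maximalRealSubfield L)) L (IsCMField.complexConj L) 3 e₁ (Matrix.diagonal dV)
                      (complexConj_imagUnit L) (imagUnit_ne_zero L) (imagUnit_mul_self L) (realDiagonal_isSymm L dV hdV)
                      (isUnit_det_realDiagonal L dV hdV hdV0) (realDiagonal_map L dV hdV).symm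
                      (fun a => isCompatible_chiSplittingLine L e₁ dV hdV hdV0 (toHeckeCharacter L μ)
                        (isUnitary_toHeckeCharacter L μ) ((isOscillatorChar_toHeckeCharacter_iff μ).mpr hμ)
                        (TW (↥(maximalRealSubfield L)) a) (isSymm_TW (↥(maximalRealSubfield L)) a)
                        (isUnit_det_TW (↥(maximalRealSubfield L)) a) (JW (↥(maximalRealSubfield L)) L a)
                        (JW_eq (↥(maximalRealSubfield L)) L a)) ιV a χ) →
                P.HasFinComponent
                    (rhoAtLine (↥(maximalRealSubfield L)) L (IsCMField.complexConj L) 3 e₁ (Matrix.diagonal dV)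
                      (complexConj_imagUnit L) (imagUnit_ne_zero L) (imagUnit_mul_self L) (realDiagonal_isSymm L dV hdV)
                      (isUnit_det_realDiagonal L dV hdV hdV0) (realDiagonal_map L dV hdV).symm
                      (fun a => isCompatible_chiSplittingLine L e₁ dV hdV hdV0 (toHeckeCharacter L μ')
                        (isUnitary_toHeckeCharacter L μ') ((isOscillatorChar_toHeckeCharacter_iff μ').mpr hμ')
                        (TW (↥(maximalRealSubfield L)) a) (isSymm_TW (↥(maximalRealSubfield L)) a)
                        (isUnit_det_TW (↥(maximalRealSubfield L)) a) (JW (↥(maximalRealSubfield L)) L a)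
                        (JW_eq (↥(maximalRealSubfield L)) L a)) ιV a' χ') →
                ∃ f :
                    (omegaAtLine (↥(maximalRealSubfield L)) L (IsCMField.complexConj L) 3 e₁ (Matrix.diagonal dV)
                      (complexConj_imagUnit L) (imagUnit_ne_zero L) (imagUnit_mul_self L) (realDiagonal_isSymm L dV hdV)
                      (isUnit_det_realDiagonal L dV hdV hdV0) (realDiagonal_map L dV hdV).symm
                      (fun a => isCompatible_chiSplittingLine L e₁ dV hdV hdV0 (toHeckeCharacter L μ)
                        (isUnitary_toHeckeCharacter L μ) ((isOscillatorChar_toHeckeCharacter_iff μ).mpr hμ)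
                        (TW (↥(maximalRealSubfield L)) a) (isSymm_TW (↥(maximalRealSubfield L)) a)
                        (isUnit_det_TW (↥(maximalRealSubfield L)) a) (JW (↥(maximalRealSubfield L)) L a)
                        (JW_eq (↥(maximalRealSubfield L)) L a)) a χ) ≃ₗ[ℂ]
                    (omegaAtLine (↥(maximalRealSubfield L)) L (IsCMField.complexConj L) 3 e₁ (Matrix.diagonal dV)
                      (complexConj_imagUnit L) (imagUnit_ne_zero L) (imagUnit_mul_self L) (realDiagonal_isSymm L dV hdV)
                      (isUnit_det_realDiagonal L dV hdV hdV0) (realDiagonal_map L dV hdV).symm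
                      (fun a => isCompatible_chiSplittingLine L e₁ dV hdV hdV0 (toHeckeCharacter L μ')
                        (isUnitary_toHeckeCharacter L μ') ((isOscillatorChar_toHeckeCharacter_iff μ').mpr hμ')
                        (TW (↥(maximalRealSubfield L)) a) (isSymm_TW (↥(maximalRealSubfield L)) a)
                        (isUnit_det_TW (↥(maximalRealSubfield L)) a) (JW (↥(maximalRealSubfield L)) L a)
                        (JW_eq (↥(maximalRealSubfield L)) L a)) a' χ'),
                  ∀ (k : finAdelic (↥(maximalRealSubfield L)) L (IsCMField.complexConj L) 3 H)
                    (x :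
                    (omegaAtLine (↥(maximalRealSubfield L)) L (IsCMField.complexConj L) 3 e₁ (Matrix.diagonal dV)
                      (complexConj_imagUnit L) (imagUnit_ne_zero L) (imagUnit_mul_self L) (realDiagonal_isSymm L dV hdV)
                      (isUnit_det_realDiagonal L dV hdV hdV0) (realDiagonal_map L dV hdV).symm
                      (fun a => isCompatible_chiSplittingLine L e₁ dV hdV hdV0 (toHeckeCharacter L μ)
                        (isUnitary_toHeckeCharacter L μ) ((isOscillatorChar_toHeckeCharacter_iff μ).mpr hμ)
                        (TW (↥(maximalRealSubfield L)) a) (isSymm_TW (↥(maximalRealSubfield L)) a)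
                        (isUnit_det_TW (↥(maximalRealSubfield L)) a) (JW (↥(maximalRealSubfield L)) L a)
                        (JW_eq (↥(maximalRealSubfield L)) L a)) a χ)),
                    f (
                    (rhoAtLine (↥(maximalRealSubfield L)) L (IsCMField.complexConj L) 3 e₁ (Matrix.diagonal dV)
                      (complexConj_imagUnit L) (imagUnit_ne_zero L) (imagUnit_mul_self L) (realDiagonal_isSymm L dV hdV)
                      (isUnit_det_realDiagonal L dV hdV hdV0) (realDiagonal_map L dV hdV).symm
                      (fun a => isCompatible_chiSplittingLine L e₁ dV hdV hdV0 (toHeckeCharacter L μ)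
                        (isUnitary_toHeckeCharacter L μ) ((isOscillatorChar_toHeckeCharacter_iff μ).mpr hμ)
                        (TW (↥(maximalRealSubfield L)) a) (isSymm_TW (↥(maximalRealSubfield L)) a)
                        (isUnit_det_TW (↥(maximalRealSubfield L)) a) (JW (↥(maximalRealSubfield L)) L a)
                        (JW_eq (↥(maximalRealSubfield L)) L a)) ιV a χ) k x) =
                    (rhoAtLine (↥(maximalRealSubfield L)) L (IsCMField.complexConj L) 3 e₁ (Matrix.diagonal dV)
                      (complexConj_imagUnit L) (imagUnit_ne_zero L) (imagUnit_mul_self L) (realDiagonal_isSymm L dV hdV)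
                      (isUnit_det_realDiagonal L dV hdV hdV0) (realDiagonal_map L dV hdV).symm
                      (fun a => isCompatible_chiSplittingLine L e₁ dV hdV hdV0 (toHeckeCharacter L μ')
                        (isUnitary_toHeckeCharacter L μ') ((isOscillatorChar_toHeckeCharacter_iff μ').mpr hμ')
                        (TW (↥(maximalRealSubfield L)) a) (isSymm_TW (↥(maximalRealSubfield L)) a)
                        (isUnit_det_TW (↥(maximalRealSubfield L)) a) (JW (↥(maximalRealSubfield L)) L a)
                        (JW_eq (↥(maximalRealSubfield L)) L a)) ιV a' χ') k (f x) := by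
  intro L _ _ _ ι H T hT hdef h2 n' e₁ dV hdV hdV0 g hg ιV hιV μA _ P μ hμ a χ μ' hμ' a' χ' hP hP'
  -- Step 1 — both carriers are irreducible and admissible (★ CI road, general CM frame)
  have hirr := F0P2cStubCI.rhoAtLine_chi_isIrreducible L H e₁ dV hdV hdV0 g hg ιV hιV μ hμ a χ
  have hirr' := F0P2cStubCI.rhoAtLine_chi_isIrreducible L H e₁ dV hdV hdV0 g hg ιV hιV μ' hμ' a' χ'
  have hadm := F0P2cStubCI.rhoAtLine_chi_isAdmissible L H e₁ dV hdV hdV0 g hg ιV hιV μ hμ a χ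
  have hadm' := F0P2cStubCI.rhoAtLine_chi_isAdmissible L H e₁ dV hdV hdV0 g hg ιV hιV μ' hμ' a' χ'
  -- Step 2 — the smooth part of `P|_{U(H)(𝔸_f)}` is `σ`-isotypic (component `= ⊤`) and isotypic of type `σ′` (★ P3 brick I♭)
  have hS := F0P3FinPartIsotypic.isotypicComponent_finRep_smoothPart_eq_top P _ hirr hadm hP
  have hS' := F0P3FinPartIsotypic.isIsotypicOfType_finRep_smoothPart P _ hirr' hadm' hP'
  -- Step 3 — it is non-zero: `σ ≠ 0` embeds into it
  obtain ⟨f₁, hf₁⟩ := F0P3FinRepConstituentsExist.exists_intertwiningMap_smoothPart_of_hasFinComponent P hadm.isSmooth hP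
  haveI hW := @Literature.RepresentationTheory.Semisimple.Representation.nontrivial_of_isIrreducible _ _ _ _ _ _ _ _ hirr
  haveI : Nontrivial ((Representation.smoothPart P.finRep).toRepresentation).asModule := hf₁.nontrivial
  haveI := (Representation.irreducible_iff_isSimpleModule_asModule _).mp hirr
  -- Step 4 — a non-zero isotypic module has a unique simple type: `σ.asModule ≃ σ′.asModule` over `ℂ[U(H)(𝔸_f)]`
  obtain ⟨e'⟩ := nonempty_linearEquiv_of_isotypicComponent_eq_top_of_isIsotypicOfType hS hS'
  -- Step 5 — back to an equivariant `ℂ`-linear equivalence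
  let E := ((Representation.IntertwiningMap.equivLinearMapAsModule _ _).symm e'.toLinearMap).ofBijective e'.bijective
  refine ⟨E.toLinearEquiv, fun k x => ?_⟩
  change E.toLinearEquiv.toLinearMap _ = _
  rw [Representation.Equiv.toLinearEquiv_toLinearMap]
  exact Representation.IntertwiningMap.isIntertwining _ _ E.toIntertwiningMap k x

end Summit.HodgeConjecture.HodgeConjecture.Cruxes.H413.F0P2mFinIsotypy

end
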